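import Mathlib
import Summits.QuantumFields.BalabanUV.T4Continuum.Support.SliceCovariantSkeleton

/-!
# T⁴ programme, node NE3 (η-rate of the minimisers) — the covariant skeleton with a LEVEL-FREE PRINCIPAL PART and
# POSITIVITY BY NAME ([B9] Theorem 3.11): `G_j = (E + a_j·Q_j(U)ᵀQ_j(U) + N_j)⁻¹` for ANY level-free `E`

Thirteenth generation of the NE3 prover lineage P1 of the cell `pub-balaban`, file 4.  The covariant edition
`SliceCovariantSkeleton.ne3Shape_torusCov_of_printedStatements` (p198241) defines the auxiliary propagators as
`gLev = (lapMat + a_j·Q_jᵀQ_j + N_j)⁻¹` with `lapMat` = pv21's `D_U*D_U` — the covariant Laplacian on FUNCTIONS `St × Cp → ℝ`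
(0-forms with colour: literally the operator `Δ′_a = Δ_U + Q′*aQ′` of [B9] (3.23)–(3.24), whose inverse `G′(U)` is the
object of [B9] Theorem 3.1) — and takes invertibility from pv21's mechanism `posDef_covLapCov` + `N_j ⪰ 0`.  The Green's
functions of the minimiser's linear response ([B11] §E: `𝔊`) are 1-FORM propagators ([B9] Thm 3.3's `G(U)`; at `U = 1`
[B5] (1.73) `Δ_a = Δ − ∂P∂* + aQ*Q`): their level-free principal part is NOT `D_U*D_U` on sites (it is the 1-form operator
with the curvature coupling, and positivity holds only JOINTLY with the gauge-fixing form — [B9] Theorem 3.11 / [B5]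
Prop. 1.1).  THIS FILE removes the dependence on the principal part:
 * §1 (generic, any internal-index carrier) `kLevE E … j = E + kPart j`, `gLevE = (kLevE)⁻¹` for an ARBITRARY level-free
   matrix `E`; the Laplacian-free identities `kLevE_sub_kLevE`, `sliceKernel_kPart_E`; two-sided inverses, symmetry and the
   RESOLVENT TELESCOPING `sum_sliceKernel_covE` from a POSITIVITY HYPOTHESIS `hpos : (kLevE … j).PosDef` per level (the
   printed Theorem 3.11, not a mechanism); the special case `kLevE lapMat = kLev` (`rfl`) with `hpos` a THEOREM
   (`posDef_kLevE_lapMat` = `SliceCovariantModel.posDef_kFull`) — so p198241 is the instance `E := lapMat`;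
 * §2 `sliceKernel_bound_torusCovE_of_printedType` (slices of `gLevE`/`kPart` on the torus, printed type by name);
 * §3 **`ne3Shape_torusCovE_of_printedStatements`** — THE NE3 SKELETON, COVARIANT EDITION WITH LEVEL-FREE PRINCIPAL PART:
   data per `(k, V)` = a bond structure (for the combs), isometric transports `Rm k V` (`hRm`, for `|τ| ≤ 1`), combs with
   `blk = cube` (`hblk`), masses `0 ≤ am ≤ amax`, gauge forms `Ng k V j` (NO sign hypothesis), derivative matrix `D k V`,
   and a level-free principal part `E k V` (ANY matrix); STABILITY = `B9.Thm31Printed` / `B9.Stmt349Printed` for the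
   matrix carriers of `gLevE` AND `B9.Thm311Printed` (positivity of `E + a_j·Q_jᵀQ_j + N_j`, Theorem 3.11 BY NAME, one
   threshold block `M₃, a₀`); CONSISTENCY = as in p198241 (`hdl` on a row of `G_k·D` over the coloured face skeleton,
   telescoped inside the proof by `sum_sliceKernel_covE` under the printed positivity).  CONCLUSION: printed thresholds
   `M₁, a₀ > 0` (now the max/min of THREE printed blocks) such that … `∃ C′, NE3Shape R C′ (L^{−a})`.
WHAT CHANGED vs p198241: `hc`, `hNg` GONE; positivity is the printed Theorem 3.11 by name instead of pv21's 0-form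
mechanism; the principal part is free, so the SAME theorem covers the 0-form family (`E = lapMat`, positivity a theorem)
and the 1-form family (E = the level-free part of Bałaban's `Δ(U) + DRD*`-type operator, positivity = Thm 3.11).
WHAT REMAINS: the readings (I′)/(I″) (`hT31 hT349 hT311` for THIS family, `hA0 hA1 hF3 hbd`) and the located, UNPRINTED
consistency readings — unchanged.  HONEST: which `E`, `Ng`, `D`, `Rm`, comb realise Bałaban's `G_j(U)` is the typing of
[B9] §3 / [B11] §E (U1a-sized), not done here; NE3 is NOT proved.

Honest framing: finite-T⁴ ultraviolet bookkeeping about MINIMISERS (rung (B)+1 of the cell's ladder); no conditional of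
the cell (`BetaPertH`, (B), (B^μ)) is used or hidden; nothing bears on infinite volume, a mass gap, or the Clay problem;
**NE3 is NOT proved**.  ABSOLUTE RULE of the cell kept: B9's theorems enter only as HYPOTHESES of the tree's typed,
cite-tagged shapes (`B9.Thm31Printed`, `B9.Stmt349Printed`, `B9.Thm311Printed`); nothing printed is asserted; the
manuscripts under audit are not cited for any disputed step.  No `sorry`, no axioms beyond Mathlib's.  PLACEMENT (human
rule 2026-08-19): cell work under `Summits/QuantumFields/BalabanUV/`; imports `Support.SliceCovariantSkeleton` (p198241);
moves nothing.  Records: `t4/T4-EST-U1b-OSC.md` v1.25 (RESULT 32), `t4/T4-EST-NE3-P1.md` v2.24, GAPS G-ne3p1-39 of the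
cell `pub-balaban`.
-/

noncomputable section

open Finset Real Matrix

namespace Summit.QuantumFields.BalabanUV.T4Continuum.SliceCovariantPrincipal

open Literature.MathematicalPhysics.QuantumFieldTheory.Balaban1983to89
open Literature.MathematicalPhysics.QuantumFieldTheory.Balaban1983to89.TreeLengthTorus (TPt)
open Literature.MathematicalPhysics.QuantumFieldTheory.Balaban1983to89.B9Thm37GlueTorusCov (Comb)
open Literature.MathematicalPhysics.QuantumFieldTheory.Balaban1983to89.T4SliceTelescoping
  (sliceKernel sliceConst sum_sliceKernel)
open Literature.MathematicalPhysics.QuantumFieldTheory.Balaban1983to89.T4EtaRateMin (Readings NE3Shape)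
open Literature.MathematicalPhysics.QuantumFieldTheory.Balaban1983to89.T4FixedPointResponse (OneStepCorrectionRate)
open Literature.MathematicalPhysics.QuantumFieldTheory.Balaban1983to89.T4SliceOperatorData
open Summit.QuantumFields.BalabanUV.T4Continuum.SliceTorusBlocks
open Summit.QuantumFields.BalabanUV.T4Continuum.SliceTorusBlockModel
open Summit.QuantumFields.BalabanUV.T4Continuum.SliceTorusTower
open Summit.QuantumFields.BalabanUV.T4Continuum.SliceTorusFaces
open Summit.QuantumFields.BalabanUV.T4Continuum.SliceCovariantModel
open Summit.QuantumFields.BalabanUV.T4Continuum.SliceCovariantTower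
open Summit.QuantumFields.BalabanUV.T4Continuum.SliceCovariantSkeleton

/-! ## §1  Level families with a level-free principal part `E` and positivity as a hypothesis -/
section Generic

variable {St Bd Cp : Type} [Fintype Cp] [DecidableEq Cp] {src tgt : Bd → St}
  {Bk : ℕ → Type} [∀ j, DecidableEq (Bk j)]
  (E : Matrix (St × Cp) (St × Cp) ℝ) (Kc : ∀ j, Comb src tgt (Bk j)) (Rm : Bd → Cp → Cp → ℝ) (w a : ℕ → ℝ)
  (Ng : ℕ → Matrix (St × Cp) (St × Cp) ℝ)

/-- The level-`j` operator with a LEVEL-FREE PRINCIPAL PART `E` (MODEL: `E` = the covariant Laplacian of the relevant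
form degree, with its curvature couplings; `kPart j = a_j·Q_jᵀQ_j + N_j` the level-`j` averaging and gauge-fixing terms of
`SliceCovariantModel`). [model] -/
def kLevE (j : ℕ) : Matrix (St × Cp) (St × Cp) ℝ := E + kPart Kc Rm w a Ng j

/-- **The principal part cancels in the level differences**, whatever it is. [folklore] -/
theorem kLevE_sub_kLevE (i : ℕ) :
    kLevE E Kc Rm w a Ng i - kLevE E Kc Rm w a Ng (i + 1) = kPart Kc Rm w a Ng i - kPart Kc Rm w a Ng (i + 1) :=
  add_sub_add_left_eq_sub _ _ _

variable [Fintype St] [DecidableEq St]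

/-- Its Green's matrix `G_j = (E + a_j·Q_jᵀQ_j + N_j)⁻¹` (MODEL of the level-`j` auxiliary propagator). [model] -/
def gLevE (j : ℕ) : Matrix (St × Cp) (St × Cp) ℝ := (kLevE E Kc Rm w a Ng j)⁻¹

/-- Hence the slices built from the non-principal parts ARE the slices of the full level operators. [folklore] -/
theorem sliceKernel_kPart_E (D : Matrix (St × Cp) (St × Cp) ℝ) :
    sliceKernel (gLevE E Kc Rm w a Ng) (kPart Kc Rm w a Ng) D
      = sliceKernel (gLevE E Kc Rm w a Ng) (kLevE E Kc Rm w a Ng) D := by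
  funext i x y
  cases i with
  | zero => rfl
  | succ i => simp only [sliceKernel, kLevE_sub_kLevE]

variable {E Kc Rm w a Ng}

/-- `G_j·K_j = 1` from the POSITIVITY of the level operator (the printed Theorem 3.11, as a hypothesis). [folklore] -/
theorem gLevE_mul_kLevE {j : ℕ} (hpos : (kLevE E Kc Rm w a Ng j).PosDef) :
    gLevE E Kc Rm w a Ng j * kLevE E Kc Rm w a Ng j = 1 :=
  nonsing_inv_mul _ ((isUnit_iff_isUnit_det _).mp hpos.isUnit)

/-- `K_j·G_j = 1` from positivity. [folklore] -/
theorem kLevE_mul_gLevE {j : ℕ} (hpos : (kLevE E Kc Rm w a Ng j).PosDef) :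
    kLevE E Kc Rm w a Ng j * gLevE E Kc Rm w a Ng j = 1 :=
  mul_nonsing_inv _ ((isUnit_iff_isUnit_det _).mp hpos.isUnit)

/-- `G_j` is symmetric (a positive definite real matrix is symmetric, and so is its inverse). [folklore] -/
theorem gLevE_transpose {j : ℕ} (hpos : (kLevE E Kc Rm w a Ng j).PosDef) :
    (gLevE E Kc Rm w a Ng j)ᵀ = gLevE E Kc Rm w a Ng j := by
  rw [gLevE, transpose_nonsing_inv, transpose_eq_of_posDef hpos]

/-- `G_j` is positive definite. [folklore] -/
theorem posDef_gLevE {j : ℕ} (hpos : (kLevE E Kc Rm w a Ng j).PosDef) : (gLevE E Kc Rm w a Ng j).PosDef :=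
  hpos.inv

/-- **RESOLVENT TELESCOPING from positivity alone**: `Σ_{i≤k} sliceKernel gLevE kPart D i = (G_k·D)` for any level-free
principal part, any transport, any gauge forms, as soon as every level operator is positive definite. [folklore] -/
theorem sum_sliceKernel_covE (hpos : ∀ j, (kLevE E Kc Rm w a Ng j).PosDef) (D : Matrix (St × Cp) (St × Cp) ℝ)
    (k : ℕ) (x y : St × Cp) :
    ∑ i ∈ Finset.range (k + 1), sliceKernel (gLevE E Kc Rm w a Ng) (kPart Kc Rm w a Ng) D i x y =
      (gLevE E Kc Rm w a Ng k * D) x y := by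
  rw [sliceKernel_kPart_E]
  exact sum_sliceKernel _ _ D (fun j => gLevE_mul_kLevE (hpos j)) (fun j => kLevE_mul_gLevE (hpos j)) k x y

variable (Kc Rm w a Ng) [Fintype Bd]

/-- **The 0-form instance**: with `E := lapMat` (pv21's `D_U*D_U`) the level operator IS `SliceCovariantModel.kLev`, by
`rfl`. [folklore] -/
theorem kLevE_lapMat (c : Bd → ℝ) (j : ℕ) : kLevE (lapMat src tgt c Rm) Kc Rm w a Ng j = kLev Kc c Rm w a Ng j := rfl

/-- `gLevE lapMat = gLev`. [folklore] -/
theorem gLevE_lapMat (c : Bd → ℝ) (j : ℕ) : gLevE (lapMat src tgt c Rm) Kc Rm w a Ng j = gLev Kc c Rm w a Ng j := rfl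

variable {Kc Rm w a Ng} [∀ j, Fintype (Bk j)]

/-- **In the 0-form instance the positivity hypothesis is a THEOREM** (pv21's mechanism: `D_U*D_U + a·Q_UᵀQ_U ≻ 0`
for every isometric transport, plus `N_j ⪰ 0`) — so `SliceCovariantSkeleton.ne3Shape_torusCov_of_printedStatements` is the
instance `E := lapMat` of §3 below. [folklore] -/
theorem posDef_kLevE_lapMat {c : Bd → ℝ} (hRm : ∀ b i j, ∑ k, Rm b k i * Rm b k j = if i = j then (1 : ℝ) else 0)
    (hc : ∀ b, c b ≠ 0) (hw : ∀ j, w j ≠ 0) (ha : ∀ j, 0 < a j) (hNg : ∀ j, (Ng j).PosSemidef) (j : ℕ) :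
    (kLevE (lapMat src tgt c Rm) Kc Rm w a Ng j).PosDef := by
  rw [kLevE_lapMat, kLev_eq_kFull]
  exact posDef_kFull (Kc j) c (fun _ => w j) Rm hRm hc (fun _ => hw j) (ha j) (hNg j)

end Generic

/-! ## §2  The slice bounds of printed TYPE for the family with a level-free principal part -/
section PrintedType

variable (d n N L : ℕ) [NeZero N] [NeZero L] (Cp Bd : Type) [Fintype Cp] [DecidableEq Cp]

/-- **THE SLICE BOUNDS `hg` FOR `G_j = (E + a_j·Q_jᵀQ_j + N_j)⁻¹` FROM (3.42)/(3.49) OF PRINTED TYPE** — `E` any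
level-free matrix; `hτ` = `abs_tau_le_one` (isometric transport), `hK` = `kPart_eq_massKernel` (combs with `blk = cube`).
HONEST: the reading that [B9] Theorem 3.1/3.3 and (3.49) give `h342`/`h349` for this family is NOT made here. [folklore] -/
theorem sliceKernel_bound_torusCovE_of_printedType (Mbig : ℝ)
    (dist : ∀ j : ℕ, TPt d (levM n N L j) → TPt d (levM n N L j) → ℝ)
    (Bg : ℕ → B9.Backgrounds) (U : ∀ j, (Bg j).Cfg)
    (A F : ∀ j, Fin 4 → (Bg j).Cfg → Matrix (TPt d (N * L ^ n) × Cp) (TPt d (N * L ^ n) × Cp) ℝ)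
    (E : Matrix (TPt d (N * L ^ n) × Cp) (TPt d (N * L ^ n) × Cp) ℝ)
    (src tgt : Bd → TPt d (N * L ^ n)) (Kc : ∀ j : ℕ, Comb src tgt (TPt d (levM n N L j)))
    (Rm : Bd → Cp → Cp → ℝ) (am : ℕ → ℝ)
    (Ng : ℕ → Matrix (TPt d (N * L ^ n) × Cp) (TPt d (N * L ^ n) × Cp) ℝ)
    (D : Matrix (TPt d (N * L ^ n) × Cp) (TPt d (N * L ^ n) × Cp) ℝ) {B₀ δ₀ C₃ δ₁ δ amax : ℝ}
    (hd : 1 ≤ d) (hB₀ : 0 ≤ B₀) (hC₃ : 0 ≤ C₃) (hδ : 0 ≤ δ) (hδ₀ : δ < δ₀) (hδ₁ : δ ≤ δ₁ / 2) (hamax : 0 ≤ amax)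
    (hRm : ∀ b i j, ∑ k, Rm b k i * Rm b k j = if i = j then (1 : ℝ) else 0)
    (hblk : ∀ j x, (Kc j).blk x = cube d n N L j x)
    (hbd : ∀ j y y₁, (nbd d n N L j y y₁ : ℝ) ≤ dist j y y₁)
    (hA0 : ∀ j, A j 0 (U j) = gLevE E Kc Rm (wB L d) (aB L d am) Ng j)
    (hA1 : ∀ j, A j 1 (U j) = (gLevE E Kc Rm (wB L d) (aB L d am) Ng j * D).transpose)
    (hF3 : ∀ j, F j 3 (U j) = Ng j)
    (h342 : ∀ j, B9.Ineq342_346_347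
      (matrixFamily (cubeI d n N L Cp j) (dist j) j (L : ℝ) Mbig (A j)) B₀ δ₀ (U j))
    (h349 : ∀ j, B9.Ineq349 d
      (fineKernelOf (cubeI d n N L Cp j) (dist j) j (L : ℝ) Mbig (F j)) C₃ δ₁ (U j))
    (ham : ∀ j, 0 ≤ am j ∧ am j ≤ amax) :
    ∀ i x y, |sliceKernel (gLevE E Kc Rm (wB L d) (aB L d am) Ng) (kPart Kc Rm (wB L d) (aB L d am) Ng) D i x y|
      ≤ printedCA B₀ δ₀ δ d ((2 : ℝ) ^ d) d
          * (1 + printedCA B₀ δ₀ δ d ((2 : ℝ) ^ d) d * printedCP amax C₃ δ₁ δ L d d)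
        * (Real.exp (-(δ * (rhoI d n N L Cp x y / (L : ℝ) ^ i))) / ((L : ℝ) ^ i) ^ (d - 1)) :=
  sliceKernel_bound_torusI_of_printedType d n N L Cp Mbig dist Bg U A F
    (gLevE E Kc Rm (wB L d) (aB L d am) Ng) Ng (kPart Kc Rm (wB L d) (aB L d am) Ng) D
    (fun j => tau (Kc j) Rm) am hd hB₀ hC₃ hδ hδ₀ hδ₁ hamax hbd hA0 hA1 hF3 h342 h349
    (fun j z w => abs_tau_le_one (Kc j) Rm hRm z w) ham (kPart_eq_massKernel Kc Rm am Ng hblk)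

end PrintedType

/-! ## §3  THE NE3 SKELETON, COVARIANT EDITION WITH A LEVEL-FREE PRINCIPAL PART AND POSITIVITY BY NAME -/
section Skeleton

variable (d N L : ℕ) [NeZero N] [NeZero L] (Cp : Type) [Fintype Cp] [DecidableEq Cp] (Bd : ℕ → Type)

/-- **NE3's typed skeleton, covariant edition with a level-free principal part (torus `(ℤ/NL^k)^d × Cp`, printed
statements by name — Theorems 3.1, (3.49) AND 3.11).**  As `SliceCovariantSkeleton.ne3Shape_torusCov_of_printedStatements`
(p198241) with TWO changes: (i) the auxiliary propagators are `G k V j := gLevE (E k V) … j = (E_{k,V} + a_j·Q_j(U)ᵀQ_j(U) +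
N_j)⁻¹` for an ARBITRARY level-free matrix `E k V` (the principal part: the covariant Laplacian of the relevant form degree
with its curvature couplings — NOT modelled) and gauge forms `Ng k V j` WITHOUT sign hypothesis; (ii) their invertibility
is the printed POSITIVITY, [B9] Theorem 3.11, BY NAME: `hT311 : B9.Thm311Printed c35 geo Bg (fun p _ _ => (kLevE …).PosDef)`
(one threshold block `M₃, a₀`, under the class (3.35) — exactly as printed), used inside the proof to telescope the located
reading `hdl` (a row of `G_k·D` over the coloured unit-face skeleton) into the slice sum (`sum_sliceKernel_covE`).
Everything else — the stability readings `hT31`/`hT349` with `hA0 hA1 hF3 hbd`, the structural data `hRm` (isometric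
transport, for `|τ| ≤ 1`), `hblk` (comb blocks = cubes), `0 ≤ am ≤ amax`, and the located, UNPRINTED consistency readings
`h1 h3 h4 h5 ht hosc hread hresp hpair` — is as in p198241.  CONCLUSION: printed thresholds `M₁, a₀ > 0` (max/min of the
three printed blocks) exist such that, once `M₁ ≤ M`, `Mα₀ ≤ a₀` and every background `U k V j` (`V ∈ dom`) is in the
class (3.35), `NE3Shape R C′ (L^{−a})` for some `C′`.  The 0-form instance `E := lapMat` has `hT311` as a THEOREM
(`posDef_kLevE_lapMat`).  HONEST: a SKELETON — NE3 is NOT proved. [folklore] -/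
theorem ne3Shape_torusCovE_of_printedStatements {ι : Type} {Xr : Type*} [Fintype Xr] {R : Readings ι Xr} (M c35 : ℝ)
    (Bg : ℕ → ι → ℕ → B9.Backgrounds) (U : ∀ k V j, (Bg k V j).Cfg)
    (dist : ∀ k j : ℕ, TPt d (levM k N L j) → TPt d (levM k N L j) → ℝ)
    (A Fk : ∀ (k : ℕ) (V : ι) (j : ℕ), Fin 4 → (Bg k V j).Cfg →
      Matrix (TPt d (N * L ^ k) × Cp) (TPt d (N * L ^ k) × Cp) ℝ)
    (E : ∀ k : ℕ, ι → Matrix (TPt d (N * L ^ k) × Cp) (TPt d (N * L ^ k) × Cp) ℝ)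
    (src tgt : ∀ k : ℕ, Bd k → TPt d (N * L ^ k))
    (Kc : ∀ (k : ℕ) (_ : ι) (j : ℕ), Comb (src k) (tgt k) (TPt d (levM k N L j)))
    (Rm : ∀ k : ℕ, ι → Bd k → Cp → Cp → ℝ) (am : ℕ → ι → ℕ → ℝ)
    (Ng : ∀ k : ℕ, ι → ℕ → Matrix (TPt d (N * L ^ k) × Cp) (TPt d (N * L ^ k) × Cp) ℝ)
    (D : ∀ k : ℕ, ι → Matrix (TPt d (N * L ^ k) × Cp) (TPt d (N * L ^ k) × Cp) ℝ)
    {z dl sig blk lam t osc nrm pair : ℕ → ι → ℝ} {CJ CB B CPo CD B0 CR Γ Λr ρ₂ a amax : ℝ}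
    (hL : 2 ≤ L) (ha0 : 0 < a) (ha : a < 1) (hd : 2 ≤ d) (hamax : 0 ≤ amax)
    -- the structural data of the covariant family
    (hRm : ∀ k V b i j, ∑ m, Rm k V b m i * Rm k V b m j = if i = j then (1 : ℝ) else 0)
    (hblk : ∀ k V j x, (Kc k V j).blk x = cube d k N L j x)
    (ham : ∀ k V j, 0 ≤ am k V j ∧ am k V j ≤ amax)
    -- STABILITY: the printed family statements for THIS family (reading (I′)/(I″)), incl. POSITIVITY (Thm 3.11)
    (hbd : ∀ k j y y₁, (nbd d k N L j y y₁ : ℝ) ≤ dist k j y y₁)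
    (hT31 : B9.Thm31Printed c35
      (fun p : ℕ × ι × ℕ => blockGeom (cubeI d p.1 N L Cp p.2.2) (dist p.1 p.2.2) p.2.2 (L : ℝ) M)
      (fun p : ℕ × ι × ℕ => Bg p.1 p.2.1 p.2.2)
      (fun p : ℕ × ι × ℕ =>
        matrixFamily (cubeI d p.1 N L Cp p.2.2) (dist p.1 p.2.2) p.2.2 (L : ℝ) M (A p.1 p.2.1 p.2.2)))
    (hT349 : B9.Stmt349Printed d c35
      (fun p : ℕ × ι × ℕ => blockGeom (cubeI d p.1 N L Cp p.2.2) (dist p.1 p.2.2) p.2.2 (L : ℝ) M)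
      (fun p : ℕ × ι × ℕ => Bg p.1 p.2.1 p.2.2)
      (fun p : ℕ × ι × ℕ =>
        fineKernelOf (cubeI d p.1 N L Cp p.2.2) (dist p.1 p.2.2) p.2.2 (L : ℝ) M (Fk p.1 p.2.1 p.2.2)))
    (hT311 : B9.Thm311Printed c35
      (fun p : ℕ × ι × ℕ => blockGeom (cubeI d p.1 N L Cp p.2.2) (dist p.1 p.2.2) p.2.2 (L : ℝ) M)
      (fun p : ℕ × ι × ℕ => Bg p.1 p.2.1 p.2.2)
      (fun p _ _ => (kLevE (E p.1 p.2.1) (Kc p.1 p.2.1) (Rm p.1 p.2.1) (wB L d) (aB L d (am p.1 p.2.1))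
        (Ng p.1 p.2.1) p.2.2).PosDef))
    (hA0 : ∀ k V j, A k V j 0 (U k V j)
      = gLevE (E k V) (Kc k V) (Rm k V) (wB L d) (aB L d (am k V)) (Ng k V) j)
    (hA1 : ∀ k V j, A k V j 1 (U k V j)
      = (gLevE (E k V) (Kc k V) (Rm k V) (wB L d) (aB L d (am k V)) (Ng k V) j * D k V).transpose)
    (hF3 : ∀ k V j, Fk k V j 3 (U k V j) = Ng k V j)
    -- CONSISTENCY: the located readings (unprinted), `hdl` on a row of `G_k·D` over the face skeleton
    (hdl : ∀ k, ∀ V ∈ R.dom, ∃ x : TPt d (N * L ^ k) × Cp,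
      dl k V ≤ ∑ y ∈ faceSkelI d k N L Cp,
        |(gLevE (E k V) (Kc k V) (Rm k V) (wB L d) (aB L d (am k V)) (Ng k V) k * D k V) x y|)
    (h1 : ∀ k : ℕ, ∀ V ∈ R.dom, z k V ≤ dl k V * sig k V + blk k V)
    (h3 : ∀ k : ℕ, ∀ V ∈ R.dom, 0 ≤ sig k V ∧ sig k V ≤ CJ * lam k V)
    (h4 : ∀ k : ℕ, ∀ V ∈ R.dom, 0 ≤ blk k V ∧ blk k V ≤ CB * (1 + k * Real.log L) * lam k V)
    (h5 : ∀ k : ℕ, ∀ V ∈ R.dom, 0 ≤ lam k V ∧ lam k V ≤ B * ((L : ℝ)⁻¹ ^ k) ^ 3)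
    (hCJ : 0 ≤ CJ) (hCB : 0 ≤ CB) (hCPo : 0 ≤ CPo) (hCD : 0 ≤ CD) (hB : 0 ≤ B) (hB0 : 0 ≤ B0) (hCR : 0 ≤ CR)
    (hΓ : 0 ≤ Γ) (hΛr : 0 ≤ Λr) (hρ₂ : 0 ≤ ρ₂)
    (ht : ∀ k : ℕ, ∀ V ∈ R.dom, t k V ≤ B0 * CR * (L : ℝ)⁻¹ ^ k)
    (hosc : ∀ k : ℕ, ∀ V ∈ R.dom, osc k V ≤ (1 + CD) * (1 + CPo) * z k V / ((L : ℝ)⁻¹ ^ k) ^ 2 + t k V)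
    (hact : ∀ k : ℕ, ∀ V ∈ R.dom, R.act k V = ∑ x, R.loc k V x) (hvol : (Fintype.card Xr : ℝ) ≤ R.vol)
    (hread : ∀ k : ℕ, ∀ V ∈ R.dom, ∀ x : Xr,
      |R.loc (k + 1) V x - R.loc k V x| ≤ Λr * nrm k V + pair k V)
    (hresp : ∀ k : ℕ, ∀ V ∈ R.dom, nrm k V ≤ Γ * osc k V)
    (hpair : OneStepCorrectionRate R.dom pair ρ₂ ((L : ℝ) ^ (-a))) :
    ∃ M₁ a₀ : ℝ, 0 < M₁ ∧ 0 < a₀ ∧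
      (M₁ ≤ M → ∀ α₀ : ℝ, 0 < α₀ → M * α₀ ≤ a₀ →
        (∀ k V j, V ∈ R.dom → (Bg k V j).Reg335 c35 α₀ (U k V j)) →
          ∃ C' : ℝ, NE3Shape R C' ((L : ℝ) ^ (-a))) := by
  obtain ⟨M₁, δ₀, a₀, B₀, Bβ, Bε, Bεβ, hM₁, hδ₀, ha₀', hB₀, h31⟩ := hT31
  obtain ⟨M₁', δ₁, a₀'', C₃, hM₁', hδ₁, ha₀'', hC₃, h49⟩ := hT349
  obtain ⟨M₃, a₃, hM₃, ha₃, h311⟩ := hT311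
  refine ⟨max (max M₁ M₁') M₃, min (min a₀ a₀'') a₃, lt_max_of_lt_left (lt_max_of_lt_left hM₁),
    lt_min (lt_min ha₀' ha₀'') ha₃, fun hM α₀ hα₀ hMa hreg => ?_⟩
  have hM12 : max M₁ M₁' ≤ M := le_trans (le_max_left _ _) hM
  have hMa12 : M * α₀ ≤ min a₀ a₀'' := le_trans hMa (min_le_left _ _)
  have hLpos : 0 < L := by omega
  have hLr : (1 : ℝ) ≤ L := by exact_mod_cast one_le_L L
  -- the decay rate of the slices: `δ = min(δ₀, δ₁/2)/2`
  set δ : ℝ := min δ₀ (δ₁ / 2) / 2 with hδdef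
  have hmin : 0 < min δ₀ (δ₁ / 2) := lt_min hδ₀ (by linarith)
  have hδpos : 0 < δ := by rw [hδdef]; linarith
  have hδ₀' : δ < δ₀ := by
    have h1 : min δ₀ (δ₁ / 2) ≤ δ₀ := min_le_left _ _
    rw [hδdef]; linarith
  have hδ₁' : δ ≤ δ₁ / 2 := by
    have h1 : min δ₀ (δ₁ / 2) ≤ δ₁ / 2 := min_le_right _ _
    rw [hδdef]; linarith
  -- the level-free slice constant
  set C : ℝ := printedCA B₀ δ₀ δ d ((2 : ℝ) ^ d) d
      * (1 + printedCA B₀ δ₀ δ d ((2 : ℝ) ^ d) d * printedCP amax C₃ δ₁ δ L d d) with hCdef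
  have hC : 0 ≤ C := by
    have h1 : 0 ≤ printedCA B₀ δ₀ δ d ((2 : ℝ) ^ d) d := printedCA_nonneg hB₀.le (by positivity) hδ₀'
    have h2 : 0 ≤ printedCP amax C₃ δ₁ δ (L : ℝ) d d := printedCP_nonneg hamax hC₃.le hLr
    rw [hCdef]; positivity
  -- the printed statements, instantiated: (3.42)/(3.49)/Thm 3.11 per (k, V ∈ dom, j)
  have h342 : ∀ k, ∀ V ∈ R.dom, ∀ j, B9.Ineq342_346_347
      (matrixFamily (cubeI d k N L Cp j) (dist k j) j (L : ℝ) M (A k V j)) B₀ δ₀ (U k V j) :=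
    fun k V hV j => (h31 (k, V, j) (le_trans (le_max_left _ _) hM12) α₀ hα₀
      (le_trans hMa12 (min_le_left _ _)) (U k V j) (hreg k V j hV)).1
  have h349 : ∀ k, ∀ V ∈ R.dom, ∀ j, B9.Ineq349 d
      (fineKernelOf (cubeI d k N L Cp j) (dist k j) j (L : ℝ) M (Fk k V j)) C₃ δ₁ (U k V j) :=
    fun k V hV j => h49 (k, V, j) (le_trans (le_max_right _ _) hM12) α₀ hα₀
      (le_trans hMa12 (min_le_right _ _)) (U k V j) (hreg k V j hV)
  have hpos : ∀ k, ∀ V ∈ R.dom, ∀ j,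
      (kLevE (E k V) (Kc k V) (Rm k V) (wB L d) (aB L d (am k V)) (Ng k V) j).PosDef :=
    fun k V hV j => h311 (k, V, j) (le_trans (le_max_right _ _) hM) α₀ hα₀
      (le_trans hMa (min_le_right _ _)) (U k V j) (hreg k V j hV) 0
  -- the slice bounds `hg` for the family on every torus level, integer metric `nplI`
  have hg : ∀ k, ∀ V ∈ R.dom, ∀ i < k + 1, ∀ x y : TPt d (N * L ^ k) × Cp,
      |sliceKernel (gLevE (E k V) (Kc k V) (Rm k V) (wB L d) (aB L d (am k V)) (Ng k V))
          (kPart (Kc k V) (Rm k V) (wB L d) (aB L d (am k V)) (Ng k V)) (D k V) i x y|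
        ≤ C * (Real.exp (-(δ * ((nplI d k N L Cp x y : ℝ) / (L : ℝ) ^ i))) / ((L : ℝ) ^ i) ^ (d - 1)) := by
    intro k V hV i _ x y
    rw [cast_nplI]
    exact sliceKernel_bound_torusCovE_of_printedType d k N L Cp (Bd k) M (dist k) (Bg k V) (U k V) (A k V) (Fk k V)
      (E k V) (src k) (tgt k) (Kc k V) (Rm k V) (am k V) (Ng k V) (D k V) (by omega) hB₀.le hC₃.le hδpos.le hδ₀'
      hδ₁' hamax (hRm k V) (hblk k V) (hbd k) (hA0 k V) (hA1 k V) (hF3 k V) (h342 k V hV) (h349 k V hV)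
      (ham k V) i x y
  -- the located reading `hdl` on a row of `G_k·D`, TELESCOPED into the slice sum under the printed positivity
  have hdl' : ∀ k, ∀ V ∈ R.dom, ∃ x : TPt d (N * L ^ k) × Cp,
      dl k V ≤ ∑ y ∈ faceSkelI d k N L Cp, |∑ i ∈ Finset.range (k + 1),
        sliceKernel (gLevE (E k V) (Kc k V) (Rm k V) (wB L d) (aB L d (am k V)) (Ng k V))
          (kPart (Kc k V) (Rm k V) (wB L d) (aB L d (am k V)) (Ng k V)) (D k V) i x y| := by
    intro k V hV
    obtain ⟨x, hx⟩ := hdl k V hV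
    refine ⟨x, hx.trans (le_of_eq (Finset.sum_congr rfl fun y _ => ?_))⟩
    rw [sum_sliceKernel_covE (hpos k V hV) (D k V) k x y]
  exact ⟨_, ne3Shape_of_slices_rpow_card0 (fun k => faceSkelI d k N L Cp) (fun k => nplI d k N L Cp)
    (fun k V i => sliceKernel (gLevE (E k V) (Kc k V) (Rm k V) (wB L d) (aB L d (am k V)) (Ng k V))
      (kPart (Kc k V) (Rm k V) (wB L d) (aB L d (am k V)) (Ng k V)) (D k V) i)
    (fun k => d * (N * L ^ k)) (by exact_mod_cast hL) ha0 ha hδpos hC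
    (mul_nonneg (Nat.cast_nonneg _) faceConst_nonneg : (0 : ℝ) ≤ Fintype.card Cp * faceConst d N)
    (Nat.cast_nonneg _) (faces_hℓ d N hd) hd
    (fun k x => card_faceSkelI_zero_le x) (fun k x y _ => nplI_le x y) (faces_hN d N L)
    (fun k x r hr => card_faceSkelI_shell_le hd x r hr) hg hdl' h1 h3 h4 h5 hCJ hCB hCPo hCD hB hB0 hCR hΓ
    hΛr hρ₂ ht hosc hact hvol hread hresp hpair⟩

end Skeleton

end Summit.QuantumFields.BalabanUV.T4Continuum.SliceCovariantPrincipal
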